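import Summits.BirchSwinnertonDyer.BirchSwinnertonDyer.Theorems.AdditiveKolyvaginRoadEigen
import Summits.BirchSwinnertonDyer.BirchSwinnertonDyer.Theorems.AdditiveKolyvaginRoadLevelMembership
import HarnessLib

/-!
# Route `AdditiveKolyvaginRoad`, crux KS′ `LevelKolyvaginSystemsAdditive` (stmt-BirchSwinnertonDyer-21396) ∕ KPA′ (stmt-BirchSwinnertonDyer-21400):
# SWITCHED CANONICAL SPACES, part 4 — the sign-free switched group at level `∅`: stability under `Aut(K/ℚ)` and the EIGEN-SUM
# `dim D = dim Sw(+) + dim Sw(−)` (E-side half of the parity leg of the «FL-engine», card `irred-vertex-anchor` T2)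
# (cell `pub/bsd-wall`, width seat `bsd-wall-akr-p2x-w3` g10; `--supports stmt-BirchSwinnertonDyer-21396`, helper; E-side glue; companion of
# `…SwitchedIso.lean` (p639624), `…SwitchedRankLowering.lean` (p640569), `…SwitchedLevelDescent.lean`)

WHY. The switched level descent (`exists_level_switched_eq_bot_at_p`, part 3) reaches a level `n₀` at which the switched canonical spaces of
both signs vanish, with `#n₀ = dim Sw^{T,Λ}_∅(+) + dim Sw^{T,Λ}_∅(−)` — the two EIGEN-parts under complex conjugation. The crux card
`irred-vertex-anchor` wants `#n₀` ODD; its parity leg compares this with the parity of E's `p`-Selmer rank through the even double switch at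
`𝔭, 𝔭̄`. That comparison is naturally about the SIGN-FREE switched group `D = (E's Kummer condition at ∞ and off T) ⊓ Λ`; this file supplies the
E-side identity `dim D = dim Sw(+) + dim Sw(−)` for a `c`-STABLE `Λ` (odd `p`), reducing the parity leg to «`dim D` is odd», i.e. to the
comparison of `D` with `Sel_p(E/K)` by two one-place Lagrangian switches (`LagrangianSwitchAtP.natCard_selmerGroup_switch`, X11b currency; the
second switch has a non-Kummer base at the first place — not built) plus E's `p`-Selmer parity (stub P of 21400, PUB-shaped).

WHAT (namespace `…Theorems.AdditiveKoly`).
* §0 `finite_of_finite_eigen_cuts` — linear algebra: an involution `τ` with `2` invertible, a `τ`-stable subgroup whose two eigen-cuts are finite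
  is finite (`x ↦ (x + τx, x − τx)` is injective).
* §1 `natCast_mem_smul_asIdeal_iff` (a natural lies under `σ • v` iff under `v`); **`conjAct_mem_switchedTotal`** — `D` is `Aut(K/ℚ)`-stable when
  `Λ` is (`K` with complex infinite places): `σ` permutes the places above no member of `T` and transports Kummer conditions along
  `K_v ≃ K_{σ v}` (tree `conjAct_mem_selmerLocalKer_iff`, `galAdicCompletionEquiv`); at complex places the Kummer condition is everything.
* §2 `levelSelmerSubgroupP_empty_inf_eq` (at level `∅`, `Sw(μ) = ker(c − sgn μ) ⊓ D`, definitional); **`finrank_switched_empty_eq_eigen_add`** —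
  `dim_{𝔽_p} D = dim Sw(+) + dim Sw(−)` for odd `p`, `c` an involution, `T` finite with `0 ∉ T`, `Λ` `c`-stable (akr-p1's
  `finrank_eq_eigen_add_of_odd` on `D`; finiteness from `finite_levelSelmerSubgroupP` on the two cuts and §0).

HONEST FRAMING: theorems only; 0 definitions, 0 named facts, 0 `sorry`; standard axioms; hypotheses displayed (`c`-stability of `Λ` is the
consumer's: for `Λ` cut out by a pair of conjugate Lagrangian lines at `𝔭, 𝔭̄` it is the transport of those lines under `c`). E-side glue; closes
nothing. BSD is not proved by any of this.

References: [cite: GrossLMS1991, §5 (5.1), §10] [cite: WZhang2014, §5 (Sel^±)] [cite: CasselsFrohlichANT1967, Ch. VII §1.1].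
-/

-- single-conjunct summit: `Summit.BirchSwinnertonDyer.BirchSwinnertonDyer.…` repeats the name by design
set_option linter.dupNamespace false

noncomputable section

open scoped Classical

namespace Summit.BirchSwinnertonDyer.BirchSwinnertonDyer.Theorems.AdditiveKoly

open WeierstrassCurve NumberField IsDedekindDomain
  Literature.NumberTheory.EllipticCurves Literature.NumberTheory.GaloisRepresentations Module
  Literature.NumberTheory.Automorphic

variable (W : WeierstrassCurve ℚ) (K : Type) [Field K] [NumberField K] (p : ℕ) (c : K ≃ₐ[ℚ] K)

/-! ## §0 Linear algebra: a group with an involution whose two eigen-cuts are finite is finite (`2` invertible) -/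

/-- For an additive involution `τ` of a group `V` on which `2` is invertible (`(2u) • x = x`) and a `τ`-stable subgroup `D` whose two
eigen-cuts `ker(τ ∓ 1) ⊓ D` are finite, `D` is finite: `x ↦ (x + τ x, x − τ x)` is injective on `D`. [folklore] -/
theorem finite_of_finite_eigen_cuts {V : Type*} [AddCommGroup V] (τ : V →+ V) (hτ : ∀ x, τ (τ x) = x) (u : ℤ)
    (hu : ∀ x : V, (2 * u) • x = x) (D : AddSubgroup V) (hD : ∀ x ∈ D, τ x ∈ D)
    (hA : Finite ((τ - (1 : ℤ) • AddMonoidHom.id V).ker ⊓ D : AddSubgroup V))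
    (hB : Finite ((τ - (-1 : ℤ) • AddMonoidHom.id V).ker ⊓ D : AddSubgroup V)) : Finite D := by
  have memA : ∀ x ∈ D, x + τ x ∈ ((τ - (1 : ℤ) • AddMonoidHom.id V).ker ⊓ D : AddSubgroup V) := by
    intro x hx
    refine AddSubgroup.mem_inf.mpr ⟨?_, D.add_mem hx (hD x hx)⟩
    rw [AddMonoidHom.mem_ker, AddMonoidHom.sub_apply, one_smul, AddMonoidHom.id_apply, map_add, hτ]
    abel
  have memB : ∀ x ∈ D, x - τ x ∈ ((τ - (-1 : ℤ) • AddMonoidHom.id V).ker ⊓ D : AddSubgroup V) := by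
    intro x hx
    refine AddSubgroup.mem_inf.mpr ⟨?_, D.sub_mem hx (hD x hx)⟩
    rw [AddMonoidHom.mem_ker, AddMonoidHom.sub_apply, neg_smul, one_smul, AddMonoidHom.neg_apply,
      AddMonoidHom.id_apply, map_sub, hτ]
    abel
  refine Finite.of_injective (fun x : D ↦
    ((⟨x.1 + τ x.1, memA x.1 x.2⟩ : ((τ - (1 : ℤ) • AddMonoidHom.id V).ker ⊓ D : AddSubgroup V)),
     (⟨x.1 - τ x.1, memB x.1 x.2⟩ : ((τ - (-1 : ℤ) • AddMonoidHom.id V).ker ⊓ D : AddSubgroup V)))) ?_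
  intro x y hxy
  simp only [Prod.mk.injEq, Subtype.mk.injEq] at hxy
  obtain ⟨h1, h2⟩ := hxy
  have h3 : (2 : ℤ) • x.1 = (2 : ℤ) • y.1 := by
    rw [two_zsmul, two_zsmul]
    calc x.1 + x.1 = (x.1 + τ x.1) + (x.1 - τ x.1) := by abel
      _ = (y.1 + τ y.1) + (y.1 - τ y.1) := by rw [h1, h2]
      _ = y.1 + y.1 := by abel
  apply Subtype.ext
  calc x.1 = (2 * u) • x.1 := (hu x.1).symm
    _ = u • ((2 : ℤ) • x.1) := by rw [mul_comm, mul_zsmul]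
    _ = u • ((2 : ℤ) • y.1) := by rw [h3]
    _ = (2 * u) • y.1 := by rw [mul_comm, mul_zsmul]
    _ = y.1 := hu y.1

/-! ## §1 The sign-free switched group at level `∅` and its stability under `Aut(K/ℚ)` -/

section Stable

/-- A natural number lies under the conjugate place `σ • v` iff it lies under `v` (`σ` fixes `ℕ ⊂ 𝓞 K`). [folklore] -/
theorem natCast_mem_smul_asIdeal_iff (σ : K ≃ₐ[ℚ] K) (v : HeightOneSpectrum (𝓞 K)) (t : ℕ) :
    (t : 𝓞 K) ∈ (σ • v).asIdeal ↔ (t : 𝓞 K) ∈ v.asIdeal := by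
  have h : σ • (t : 𝓞 K) = (t : 𝓞 K) := map_natCast (MulSemiringAction.toRingHom (K ≃ₐ[ℚ] K) (𝓞 K) σ) t
  conv_lhs => rw [← h]
  exact HeightOneSpectrum.smul_mem_smul_asIdeal_iff σ v (t : 𝓞 K)

/-- **The sign-free switched group at level `∅` is `Aut(K/ℚ)`-stable when `Λ` is.** For `K` with every infinite place complex, `σ ∈ Aut(K/ℚ)`,
a set `T` of naturals and a `σ`-stable subgroup `Λ ≤ H¹(K, E[p])`: the group of classes with E's Kummer condition at every infinite place and at
every finite place above no member of `T`, lying in `Λ`, is `σ`-stable — `σ` permutes the places above no member of `T`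
(`natCast_mem_smul_asIdeal_iff`) and transports Kummer conditions along `K_v ≃ K_{σ v}` (tree `conjAct_mem_selmerLocalKer_iff`,
`galAdicCompletionEquiv`); at the complex places the Kummer condition is everything. [cite: GrossLMS1991, §5 (5.1)]
[cite: CasselsFrohlichANT1967, Ch. VII §1.1] -/
theorem conjAct_mem_switchedTotal (hK : ∀ w : InfinitePlace K, w.IsComplex) (σ : K ≃ₐ[ℚ] K) (T : Set ℕ)
    (Λ : AddSubgroup (Vp W K p)) (hΛ : ∀ x ∈ Λ, conjAct W σ ((p ^ 1 : ℕ) : ℤ) x ∈ Λ) {x : Vp W K p}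
    (hx : x ∈ ((⨅ (w : InfinitePlace K), selmerLocalKer (W.baseChange K) w.Completion ((p ^ 1 : ℕ) : ℤ)) ⊓
      (⨅ (v : HeightOneSpectrum (𝓞 K)) (_ : ∀ t ∈ T, (t : 𝓞 K) ∉ v.asIdeal),
        selmerLocalKer (W.baseChange K) (v.adicCompletion K) ((p ^ 1 : ℕ) : ℤ))) ⊓ Λ) :
    conjAct W σ ((p ^ 1 : ℕ) : ℤ) x ∈
      ((⨅ (w : InfinitePlace K), selmerLocalKer (W.baseChange K) w.Completion ((p ^ 1 : ℕ) : ℤ)) ⊓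
        (⨅ (v : HeightOneSpectrum (𝓞 K)) (_ : ∀ t ∈ T, (t : 𝓞 K) ∉ v.asIdeal),
          selmerLocalKer (W.baseChange K) (v.adicCompletion K) ((p ^ 1 : ℕ) : ℤ))) ⊓ Λ := by
  obtain ⟨hx, hxΛ⟩ := AddSubgroup.mem_inf.mp hx
  obtain ⟨-, hfin⟩ := AddSubgroup.mem_inf.mp hx
  rw [AddSubgroup.mem_iInf] at hfin
  refine AddSubgroup.mem_inf.mpr ⟨AddSubgroup.mem_inf.mpr ⟨?_, ?_⟩, hΛ x hxΛ⟩
  · rw [AddSubgroup.mem_iInf]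
    intro w
    haveI : IsAlgClosed w.Completion :=
      isAlgClosed_of_ringEquiv (InfinitePlace.Completion.ringEquivComplexOfIsComplex (hK w)).symm
    rw [WeierstrassCurve.selmerLocalKer_eq_top_of_isAlgClosed]
    trivial
  · rw [AddSubgroup.mem_iInf]
    intro v'
    rw [AddSubgroup.mem_iInf]
    intro hv'
    have h : σ • (σ⁻¹ • v') = v' := smul_inv_smul σ v'
    haveI : CharZero ((σ⁻¹ • v').adicCompletion K) := charZero_of_injective_algebraMap (algebraMap K _).injective
    haveI : CharZero (v'.adicCompletion K) := charZero_of_injective_algebraMap (algebraMap K _).injective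
    refine (conjAct_mem_selmerLocalKer_iff W σ (galAdicCompletionEquiv (L := K) σ h)
      (isSemilinearRingEquiv_galAdicCompletionEquiv σ h) _ x).mpr ?_
    have hv : ∀ t ∈ T, (t : 𝓞 K) ∉ (σ⁻¹ • v').asIdeal := fun t ht h' ↦
      hv' t ht (by rwa [natCast_mem_smul_asIdeal_iff] at h')
    have := hfin (σ⁻¹ • v')
    rw [AddSubgroup.mem_iInf] at this
    exact this hv

end Stable

/-! ## §2 The switched eigenspaces at level `∅` cut the sign-free group; the eigen-sum -/

section EigenSum

/-- At level `∅` the switched canonical space of sign `μ` is the `sgn μ`-eigenspace of complex conjugation cut by the sign-free switched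
group (definitional: the toric conditions are indexed by the empty level). [cite: WZhang2014, §5 (Sel^±)] -/
theorem levelSelmerSubgroupP_empty_inf_eq (T : Set ℕ) (Λ : AddSubgroup (Vp W K p)) (μ : Bool) :
    levelSelmerSubgroupP W K p c ∅ T μ ⊓ Λ =
      (conjAct W c ((p ^ 1 : ℕ) : ℤ) - sgnP μ • AddMonoidHom.id (Vp W K p)).ker ⊓
        (((⨅ (w : InfinitePlace K), selmerLocalKer (W.baseChange K) w.Completion ((p ^ 1 : ℕ) : ℤ)) ⊓
          (⨅ (v : HeightOneSpectrum (𝓞 K)) (_ : ∀ t ∈ T, (t : 𝓞 K) ∉ v.asIdeal),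
            selmerLocalKer (W.baseChange K) (v.adicCompletion K) ((p ^ 1 : ℕ) : ℤ))) ⊓ Λ) := by
  ext x
  rw [AddSubgroup.mem_inf, mem_levelSelmerSubgroupP_iff, AddSubgroup.mem_inf, AddSubgroup.mem_inf, AddSubgroup.mem_inf,
    AddSubgroup.mem_iInf, AddSubgroup.mem_iInf, AddMonoidHom.mem_ker, AddMonoidHom.sub_apply, sub_eq_zero]
  have hfin : (∀ v : HeightOneSpectrum (𝓞 K), (∀ q ∈ ((∅ : Finset ℕ) : Set ℕ) ∪ T, (q : 𝓞 K) ∉ v.asIdeal) →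
        x ∈ selmerLocalKer (W.baseChange K) (v.adicCompletion K) ((p ^ 1 : ℕ) : ℤ)) ↔
      ∀ v : HeightOneSpectrum (𝓞 K), x ∈ ⨅ (_ : ∀ t ∈ T, (t : 𝓞 K) ∉ v.asIdeal),
        selmerLocalKer (W.baseChange K) (v.adicCompletion K) ((p ^ 1 : ℕ) : ℤ) := by
    refine forall_congr' fun v ↦ ?_
    rw [AddSubgroup.mem_iInf, Finset.coe_empty, Set.empty_union]
  have htor : ∀ q : ℕ, q ∈ (∅ : Finset ℕ) ∧ q ∉ T → ∀ v : HeightOneSpectrum (𝓞 K), (q : 𝓞 K) ∈ v.asIdeal →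
      x ∈ toricLocalKer (W.baseChange K) (v.adicCompletion K) ((p ^ 1 : ℕ) : ℤ) :=
    fun q hq ↦ absurd hq.1 (Finset.notMem_empty q)
  rw [hfin]
  constructor
  · rintro ⟨⟨hsgn, hinf, hfin', -⟩, hΛ⟩
    exact ⟨hsgn, ⟨hinf, hfin'⟩, hΛ⟩
  · rintro ⟨hsgn, ⟨hinf, hfin'⟩, hΛ⟩
    exact ⟨⟨hsgn, hinf, hfin', htor⟩, hΛ⟩

variable [W.IsElliptic] [Fact p.Prime] [Module (ZMod p) (Vp W K p)]

/-- **EIGEN-SUM FOR THE SWITCHED SPACES AT LEVEL `∅`.** `p` an odd prime, `K` with all infinite places complex (e.g. imaginary quadratic), `c`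
an involution of `K` (complex conjugation), `T` a finite set of non-zero naturals, `Λ ≤ H¹(K, E[p])` a `c`-STABLE subgroup. Then the
`𝔽_p`-dimension of the sign-free switched group `D = (Kummer at ∞ and off T) ⊓ Λ` is the sum of the dimensions of the two switched eigenspaces
`levelSelmerSubgroupP ∅ T ± ⊓ Λ` (`D` is `c`-stable by `conjAct_mem_switchedTotal`, finite because its two eigen-cuts are
(`finite_of_finite_eigen_cuts`, `finite_levelSelmerSubgroupP`), then `finrank_eq_eigen_add_of_odd`). This is the E-side half of the PARITY LEG of
the «FL-engine» (card `irred-vertex-anchor`, T2): the level `n₀` of `exists_level_switched_eq_bot_at_p` has `#n₀ = dim D`, so `#n₀` is odd iff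
`dim D` is; comparing `dim D` with `dim Sel_p(E/K)` (two one-place Lagrangian switches at `𝔭, 𝔭̄`) is not done here.
[cite: GrossLMS1991, §5 (5.1), §10] [cite: WZhang2014, §5] -/
theorem finrank_switched_empty_eq_eigen_add (hp2 : p ≠ 2) (hK : ∀ w : InfinitePlace K, w.IsComplex) (hcc : c * c = 1)
    (T : Set ℕ) (hTfin : T.Finite) (hT0 : (0 : ℕ) ∉ T) (Λ : AddSubgroup (Vp W K p))
    (hΛ : ∀ x ∈ Λ, conjAct W c ((p ^ 1 : ℕ) : ℤ) x ∈ Λ) :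
    finrank (ZMod p) (AddSubgroup.toZModSubmodule p
      (((⨅ (w : InfinitePlace K), selmerLocalKer (W.baseChange K) w.Completion ((p ^ 1 : ℕ) : ℤ)) ⊓
        (⨅ (v : HeightOneSpectrum (𝓞 K)) (_ : ∀ t ∈ T, (t : 𝓞 K) ∉ v.asIdeal),
          selmerLocalKer (W.baseChange K) (v.adicCompletion K) ((p ^ 1 : ℕ) : ℤ))) ⊓ Λ)) =
      finrank (ZMod p) (AddSubgroup.toZModSubmodule p (levelSelmerSubgroupP W K p c ∅ T true ⊓ Λ)) +
        finrank (ZMod p) (AddSubgroup.toZModSubmodule p (levelSelmerSubgroupP W K p c ∅ T false ⊓ Λ)) := by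
  have hp : p.Prime := Fact.out
  have hτ : ∀ x, conjAct W c ((p ^ 1 : ℕ) : ℤ) (conjAct W c ((p ^ 1 : ℕ) : ℤ) x) = x :=
    conjAct_conjAct_of_mul_self W hcc ((p ^ 1 : ℕ) : ℤ)
  set D : AddSubgroup (Vp W K p) :=
    ((⨅ (w : InfinitePlace K), selmerLocalKer (W.baseChange K) w.Completion ((p ^ 1 : ℕ) : ℤ)) ⊓
      (⨅ (v : HeightOneSpectrum (𝓞 K)) (_ : ∀ t ∈ T, (t : 𝓞 K) ∉ v.asIdeal),
        selmerLocalKer (W.baseChange K) (v.adicCompletion K) ((p ^ 1 : ℕ) : ℤ))) ⊓ Λ with hD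
  have hstab : ∀ x ∈ D, conjAct W c ((p ^ 1 : ℕ) : ℤ) x ∈ D := fun x hx ↦
    conjAct_mem_switchedTotal W K p hK c T Λ hΛ hx
  -- the two eigen-cuts are the switched eigenspaces
  have hplus : (conjAct W c ((p ^ 1 : ℕ) : ℤ) - (1 : ℤ) • AddMonoidHom.id _).ker ⊓ D =
      levelSelmerSubgroupP W K p c ∅ T true ⊓ Λ := by
    rw [levelSelmerSubgroupP_empty_inf_eq, show sgnP true = 1 from rfl]
  have hminus : (conjAct W c ((p ^ 1 : ℕ) : ℤ) - (-1 : ℤ) • AddMonoidHom.id _).ker ⊓ D =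
      levelSelmerSubgroupP W K p c ∅ T false ⊓ Λ := by
    rw [levelSelmerSubgroupP_empty_inf_eq, show sgnP false = -1 from rfl]
  -- finiteness of the eigen-cuts, hence of `D`
  have hfinμ : ∀ μ : Bool, Finite (levelSelmerSubgroupP W K p c ∅ T μ ⊓ Λ : AddSubgroup (Vp W K p)) := by
    intro μ
    have h1 : Finite (levelSelmerSubgroupP W K p c ∅ T μ) := by
      refine finite_levelSelmerSubgroupP W K p c _ _ hTfin ?_ μ
      rintro (h | h)
      · simp at h
      · exact hT0 h
    exact Finite.of_injective (fun y ↦ (⟨y.1, (AddSubgroup.mem_inf.mp y.2).1⟩ : levelSelmerSubgroupP W K p c ∅ T μ))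
      (fun y y' h ↦ Subtype.ext (by simpa using congrArg Subtype.val h))
  obtain ⟨u, hu⟩ := exists_two_mul_zsmul_eq_of_odd W K p (hp.odd_of_ne_two hp2)
  haveI : Finite D := finite_of_finite_eigen_cuts (conjAct W c ((p ^ 1 : ℕ) : ℤ)) hτ u hu D hstab
    (by rw [hplus]; exact hfinμ true) (by rw [hminus]; exact hfinμ false)
  have h := finrank_eq_eigen_add_of_odd W K p hp2 (conjAct W c ((p ^ 1 : ℕ) : ℤ)) hτ D hstab
  rw [hplus, hminus] at h
  exact h

end EigenSum

end Summit.BirchSwinnertonDyer.BirchSwinnertonDyer.Theorems.AdditiveKoly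

end
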